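import Summits.Ventures.Crystal3D.Theorems.StickyWulffConstantPolycrystalWulffBoundClassRowsIH

/-!
# `PolycrystalWulffBound`, line `PolyDensity`: cut-set bookkeeping for the aggregated step (part 3a)

Route `StickyWulffConstant` of the venture `Summits/Ventures/Crystal3D`, crux `PolycrystalWulffBound`
(item `stmt-Ventures-19482`), second prover lane (poly-p2, gen 4).  The aggregated step instantiates the generic
rows of `aggStaticRows` / `rec_row_classes` / `del_row_classes` at three distinguished classes `a, b, c` and the
remainder `T = univ \ {a,b,c}`; the named variables of `def AggCert27_8` (`A_1R = Σ_{r∈T} Acl a r`, `A_RR`, …) then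
require a handful of finite-sum identities, collected here once: splitting sums over `univ`, over `univ \ {a}`,
`univ \ {a,b}` and over complements of `T`-containing sets, and peeling one class off the symmetric off-diagonal
pair sum `Σ_i Σ_j [i,j ∈ P, i ≠ j] Acl i j / 2` produced by `classCross_sum`.
WHAT THIS IS NOT: the instantiation itself; F-C1 not moved.
-/

namespace Summit.Ventures.Crystal3D.Theorems

open Finset

variable {β : Type} [Fintype β] [DecidableEq β]

/-- `Σ_univ φ = φ a + φ b + φ c + Σ_{univ \ {a,b,c}} φ` for distinct `a, b, c`. -/
theorem sum_univ_split_three {a b c : β} (hab : a ≠ b) (hbc : b ≠ c) (hac : a ≠ c) (φ : β → ℝ) :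
    ∑ l, φ l = φ a + φ b + φ c + ∑ l ∈ univ \ {a, b, c}, φ l := by
  rw [← sum_sdiff (subset_univ ({a, b, c} : Finset β)), sum_insert (by simp [hab, hac]),
    sum_insert (by simp [hbc]), sum_singleton]
  ring

/-- `Σ_{univ \ {a}} φ = φ b + φ c + Σ_{univ \ {a,b,c}} φ`. -/
theorem sum_sdiff_single_split {a b c : β} (hab : a ≠ b) (hbc : b ≠ c) (hac : a ≠ c) (φ : β → ℝ) :
    ∑ l ∈ univ \ {a}, φ l = φ b + φ c + ∑ l ∈ univ \ {a, b, c}, φ l := by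
  have h1 := sum_univ_split_three hab hbc hac φ
  have h2 : ∑ l, φ l = φ a + ∑ l ∈ univ \ {a}, φ l := by
    rw [← sum_sdiff (subset_univ ({a} : Finset β)), sum_singleton]; ring
  linarith

/-- `Σ_{univ \ {a,b}} φ = φ c + Σ_{univ \ {a,b,c}} φ`. -/
theorem sum_sdiff_pair_split {a b c : β} (hab : a ≠ b) (hbc : b ≠ c) (hac : a ≠ c) (φ : β → ℝ) :
    ∑ l ∈ univ \ {a, b}, φ l = φ c + ∑ l ∈ univ \ {a, b, c}, φ l := by
  have h1 := sum_univ_split_three hab hbc hac φ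
  have h2 : ∑ l, φ l = φ a + φ b + ∑ l ∈ univ \ {a, b}, φ l := by
    rw [← sum_sdiff (subset_univ ({a, b} : Finset β)), sum_insert (by simp [hab]), sum_singleton]; ring
  linarith

/-- Complement of the remainder: `univ \ (univ \ {a,b,c}) = {a,b,c}`. -/
theorem sdiff_sdiff_three (a b c : β) : univ \ (univ \ ({a, b, c} : Finset β)) = {a, b, c} := by
  ext x; simp

/-- Complement of `{a} ∪ T`: `univ \ insert a (univ \ {a,b,c}) = {b,c} \ {a}` — for distinct classes `{b, c}`. -/
theorem sdiff_insert_remainder {a b c : β} (hab : a ≠ b) (hac : a ≠ c) :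
    univ \ insert a (univ \ ({a, b, c} : Finset β)) = {b, c} := by
  ext x
  by_cases hxa : x = a <;> by_cases hxb : x = b <;> by_cases hxc : x = c <;> simp_all

/-- Complement of `{a,b} ∪ T`: `univ \ insert a (insert b (univ \ {a,b,c})) = {c}` for distinct classes. -/
theorem sdiff_insert_insert_remainder {a b c : β} (hac : a ≠ c) (hbc : b ≠ c) :
    univ \ insert a (insert b (univ \ ({a, b, c} : Finset β))) = {c} := by
  ext x
  by_cases hxa : x = a <;> by_cases hxb : x = b <;> by_cases hxc : x = c <;> simp_all

/-- Peeling one class off the symmetric off-diagonal pair sum of `classCross_sum`: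
`Σ_i Σ_j [i,j ∈ insert a Q, i≠j] Acl i j / 2 = Σ_{j∈Q} Acl a j + Σ_i Σ_j [i,j ∈ Q, i≠j] Acl i j / 2` (`a ∉ Q`). -/
theorem offdiag_sum_insert (Acl : β → β → ℝ) (hsymm : ∀ i j, Acl i j = Acl j i) {a : β} {Q : Finset β}
    (ha : a ∉ Q) :
    (∑ i, ∑ j, (if (i ∈ insert a Q ∧ j ∈ insert a Q) ∧ i ≠ j then Acl i j / 2 else 0)) =
      (∑ j ∈ Q, Acl a j) + ∑ i, ∑ j, (if (i ∈ Q ∧ j ∈ Q) ∧ i ≠ j then Acl i j / 2 else 0) := by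
  classical
  -- restrict the outer and inner sums to the supporting sets
  have hrestrict : ∀ (P : Finset β), (∑ i, ∑ j, (if (i ∈ P ∧ j ∈ P) ∧ i ≠ j then Acl i j / 2 else 0)) =
      ∑ i ∈ P, ∑ j ∈ P, (if i ≠ j then Acl i j / 2 else 0) := by
    intro P
    rw [← sum_subset (subset_univ P)]
    · refine sum_congr rfl fun i hi => ?_
      rw [← sum_subset (subset_univ P)]
      · exact sum_congr rfl fun j hj => by simp only [hi, hj, true_and]
      · intro j _ hj; rw [if_neg]; exact fun h => hj h.1.2
    · intro i _ hi; exact sum_eq_zero fun j _ => by rw [if_neg]; exact fun h => hi h.1.1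
  rw [hrestrict, hrestrict, sum_insert ha]
  have hrow : ∑ j ∈ insert a Q, (if a ≠ j then Acl a j / 2 else 0) = ∑ j ∈ Q, Acl a j / 2 := by
    rw [sum_insert ha, if_neg (fun h => h rfl), zero_add]
    refine sum_congr rfl fun j hj => ?_
    have hne : a ≠ j := fun h => ha (by rw [h]; exact hj)
    rw [if_pos hne]
  have hcols : ∑ i ∈ Q, ∑ j ∈ insert a Q, (if i ≠ j then Acl i j / 2 else 0) =
      ∑ i ∈ Q, (Acl a i / 2 + ∑ j ∈ Q, (if i ≠ j then Acl i j / 2 else 0)) := by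
    refine sum_congr rfl fun i hi => ?_
    have hne : i ≠ a := fun h => ha (by rw [← h]; exact hi)
    rw [sum_insert ha, if_pos hne, hsymm i a]
  rw [hrow, hcols, sum_add_distrib, ← sum_div]
  ring

/-- The off-diagonal pair sum over a singleton vanishes. -/
theorem offdiag_sum_singleton (Acl : β → β → ℝ) (a : β) :
    (∑ i, ∑ j, (if (i ∈ ({a} : Finset β) ∧ j ∈ ({a} : Finset β)) ∧ i ≠ j then Acl i j / 2 else 0)) = 0 := by
  refine sum_eq_zero fun i _ => sum_eq_zero fun j _ => ?_
  rw [if_neg]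
  rintro ⟨⟨hi, hj⟩, hij⟩
  rw [mem_singleton] at hi hj
  exact hij (hi.trans hj.symm)

/-- The full off-diagonal pair sum (`P = univ`, the walls row) in the restricted form. -/
theorem offdiag_sum_univ (Acl : β → β → ℝ) :
    (∑ i, ∑ j, (if i ≠ j then Acl i j / 2 else 0)) =
      ∑ i, ∑ j, (if (i ∈ (univ : Finset β) ∧ j ∈ (univ : Finset β)) ∧ i ≠ j then Acl i j / 2 else 0) := by
  simp only [mem_univ, true_and]

end Summit.Ventures.Crystal3D.Theorems
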